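import Summits.NavierStokesRegularity.NavierStokesRegularity.Theses.FilamentSkeletonRss

/-!
# Route `FilamentSkeletonRss` · Variant A1R (clause 13-R retype): 13-R ⟹ 13-J at both ends —
# `SkeletonJ1R → SkeletonJ1L` (∃-side) and `TransverseReduction1AL → TransverseReduction1AR` (∀-side)

The director's VET item (i) of the A1R retype (DIRECTOR-NS dss_113/dss_115; tenure g26 Sketch-A1R.lean sha16 6da6dfe5…; the retype implements the LEAD's
LEAD-NOTES-23297-g12 §1.3 «clause 13-R := the augmented in-ball form of 13-J»), landed by the LEAD of the ∀-crux, lane ns-filament-21221-p1 g12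
(`--supports stmt-NavierStokesRegularity-23610 --as helper`).  Clause 13-R quantifies the conditional a-priori bound over phase-orthogonal ball-supported
normal variations `Y` AND a rate increment `dα`, with the defect measured IN THE BALL only; specialising `dα := 0` and observing that the all-τ defect bound of
13-J implies the in-ball one gives 13-J.  Hence:

* `skeletonJ1R_imp_skeletonJ1L` — the retyped ∃-crux (item 23610) implies the superseded one (23296): the ∃-side only GAINS an obligation;
* `transverseReduction1AL_imp_1AR` — the superseded ∀-crux (23297) implies the retyped one (23611): the ∀-side only gains a hypothesis, so every
  registered line / landed helper of 23297 transfers to 23611 (the LEAD's skeleton v5R composes `TransverseReduction1AL_of` with this lemma).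

Pure logic on the route decls (proofs = tenure's Sketch-A1R, re-addressed from the scratch copies to the filed decls of route rev 53).  HONEST FRAMING: MODEL rung,
negative side; no crux is proved or refuted; nothing here bears on Navier–Stokes regularity.
-/

set_option linter.dupNamespace false

namespace Summit.NavierStokesRegularity.NavierStokesRegularity.Theorems

open scoped BigOperators Topology InnerProductSpace
open Filter Set Function MeasureTheory
open Literature.Analysis.FluidPDE
open Summit.NavierStokesRegularity.NavierStokesRegularity.Theses.FilamentSkeletonRss

/-- **(i), ∃-side: `SkeletonJ1R → SkeletonJ1L`** (clause 13-R with `dα = 0` and the all-τ defect bound restricted to the ball gives clause 13-J). -/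
theorem skeletonJ1R_imp_skeletonJ1L : SkeletonJ1R → SkeletonJ1L := by
  rintro ⟨N, δ, ρ, K, Λ, a, b, cnd, η, Rw, Rb, cg, θ₀, KA, Γ₂, hN, hδ, hρ, ha, hcnd, hη, hRw, hRb, hcg, hθ, hΓ⟩
  refine ⟨N, δ, ρ, K, Λ, a, b, cnd, η, Rw, Rb, cg, θ₀, KA, Γ₂, hN, hδ, hρ, ha, hcnd, hη, hRw, hRb, hcg, hθ, fun Γ hΓ2 => ?_⟩
  obtain ⟨γ, α, X, w, c, m, n, Aa, h⟩ := hΓ Γ hΓ2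
  refine ⟨γ, α, X, w, c, m, n, Aa, fun u v A T hu hv hA hT => ?_⟩
  obtain ⟨h1, h2, h3, h4, h5, h6, h7, h8, h9, h10, h11, h12, h13, h14, h15, h16⟩ := h u v A T hu hv hA hT
  refine ⟨h1, h2, h3, h4, h5, h6, h7, h8, h9, h10, h11, h12, h13, h14, h15, ?_⟩
  intro Y hY1 hY2 hY3 hY4 hY5 L hL j τ
  have hR := h16 Y hY1 hY2 hY3 hY4 hY5 0 L (fun j τ _ => by simpa using hL j τ)
  exact hR.1 j τ

/-- **(i), ∀-side: `TransverseReduction1AL → TransverseReduction1AR`** (a hypothesis block with 13-R yields one with 13-J, to which the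
superseded ∀-crux applies). -/
theorem transverseReduction1AL_imp_1AR : TransverseReduction1AL → TransverseReduction1AR := by
  intro hTR N δ ρ K Λ a b cnd η Rw Rb cg θ₀ KA hN hδ hρ ha hη hRw hRb hcg hθ
  obtain ⟨Γ₁, hΓ⟩ := hTR N δ ρ K Λ a b cnd η Rw Rb cg θ₀ KA hN hδ hρ ha hη hRw hRb hcg hθ
  refine ⟨Γ₁, fun Γ hΓ1 γ α X w c m n Aa u v A T hu hv hA hT hblk => ?_⟩
  obtain ⟨h1, h2, h3, h4, h5, h6, h7, h8, h9, h10, h11, h12, h13, h14, h15, h16⟩ := hblk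
  refine hΓ Γ hΓ1 γ α X w c m n Aa u v A T hu hv hA hT ⟨h1, h2, h3, h4, h5, h6, h7, h8, h9, h10, h11, h12, h13, h14, h15, ?_⟩
  intro Y hY1 hY2 hY3 hY4 hY5 L hL j τ
  have hR := h16 Y hY1 hY2 hY3 hY4 hY5 0 L (fun j τ _ => by simpa using hL j τ)
  exact hR.1 j τ

/-- Consequence for the glue: the retyped selection `Selection1AR` (23613) follows from ANY proof of the superseded ∀-crux together with the retyped one's
own glue shape — recorded as the one-line transfer used by the LEAD's skeleton v5R. -/
theorem selection1AR_of_selection1AL_and_1AL (hSel : Selection1AL) (hTR : TransverseReduction1AL) : Selection1AR :=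
  fun hSk _ => hSel (skeletonJ1R_imp_skeletonJ1L hSk) hTR

end Summit.NavierStokesRegularity.NavierStokesRegularity.Theorems
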